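import Literature.Probability.Percolation.TriApproxDomainProofs

/-!
# Route CardyBondTriangular · crux `BondTriangularCardy` (stmt-CriticalPhenomena-4664), line `birth`,
# stub `stub_corner`, helper: four boundary marks around a corner of a discrete domain

Helper of the stub `stub_corner` (the corner normalisation `f²_δ(z_δ) → 1` at `R.pt 1`,
Bollobás–Riordan, *Percolation* (CUP 2006), Ch. 7, pp. 200–201, for the Chayes–Lei hexagon
representation). Model-free geometry of a 4-marked discrete domain `G = (G; v₀, v₁, v₂, v₃)` of
`δ𝕋` near its marked site `v₁`: given a point `p` with `δv₁` within `r_N/2` of `p`, the marked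
sites `v₀, v₂` and the arcs `A₂, A₃` farther than `R₂ (+13δ)` from `p` (`13δ ≤ r_N`, `4r_N ≤ R₂`),
`exists_corner_marks` produces four markable boundary positions `m 0 < m 1 < m 2 < m 3` with
distinct tails, `m 1 ≤ pos 1 < m 2 < m 2 + 1 < pos 2`, `m 3 ≤ pos 2`, such that

* every tail of a position of `[m 0, m 1)` is at distance `≥ r_N` from `p` (`m 1` is just before
  the first position whose tail enters `B(p, r_N)`),
* the tails at `m 1` and `m 2` are within `2 r_N` of `p` (`m 2` is just after `pos 1`),
* every tail of a position of `[m 3, m 0 + #∂)` is farther than `R₂` from `p` (`m 3` is just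
  after the last position before `pos 2` whose tail is within `R₂`, `m 0` just before the first
  position whose tail is within `R₂`; in between lie `A₂ ∪ A₃`).

These are the marks of the re-marked domain to which the Chayes–Lei duality lemma is applied in
the proof of the corner normalisation: a blue crossing from the stretch `[m 1, m 2)` to the
stretch `[m 3, m 0 + #∂)` is a blue arm about `p`, a yellow crossing from `[m 0, m 1)` to
`[m 2, m 3)` either separates the corner triangle or is a yellow arm about `p`. Tools: tails move
by at most one mesh per boundary step (`dist_iter_fst_le`), markable positions are frequent
(`exists_markable_near`), tails far apart along the cycle are distinct (`tail_not_interleaved`,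
`fst_ne_markSite_of_lt`).

References: B. Bollobás, O. Riordan, *Percolation*, CUP 2006, Ch. 7, §7.2.2 pp. 168–169, proof
of Claim 23 pp. 200–201.
-/

noncomputable section

namespace Summit.CriticalPhenomena.CardyFormulaZ2.Theorems.BondTriangularCardyLine

open Finset Metric
open Literature.Probability.Percolation Literature.Probability.LatticeModels

/-- **Four boundary marks around the corner `v₁`.** See the module docstring (registered helper
signature of the stub `stub_corner`, line `birth`). -/
theorem exists_corner_marks : ∀ (G : Literature.Probability.Percolation.TriMarkedDomain 4) (δ rN R₂ : ℝ) (p : ℂ), 0 < δ → 13 * δ ≤ rN → 4 * rN ≤ R₂ → dist (Literature.Probability.LatticeModels.triMeshPoint δ (G.markSite 1)) p < rN / 2 → R₂ + 13 * δ < dist (Literature.Probability.LatticeModels.triMeshPoint δ (G.markSite 0)) p → R₂ + 13 * δ < dist (Literature.Probability.LatticeModels.triMeshPoint δ (G.markSite 2)) p → (∀ t, t ∈ G.arc 2 ∨ t ∈ G.arc 3 → R₂ < dist (Literature.Probability.LatticeModels.triMeshPoint δ t) p) → ∃ m : Fin 4 → ℕ, StrictMono m ∧ (∀ j, m j < m 0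 + (Literature.Probability.Percolation.triBdryDarts G.verts).card) ∧ (∀ j, G.Markable (m j)) ∧ Function.Injective (fun j => (Literature.Probability.Percolation.triBdryIter G.verts G.base (m j)).1) ∧ m 1 ≤ G.pos 1 ∧ G.pos 1 < m 2 ∧ m 2 + 1 < G.pos 2 ∧ m 3 ≤ G.pos 2 ∧ (Literature.Probability.Percolation.triBdryIter G.verts G.base (m 2)).1 ≠ G.markSite 0 ∧ (∀ n, m 0 ≤ n → n < m 1 → rN ≤ dist (Literature.Probability.LatticeModels.triMeshPoint δ (Literature.Probability.Percolation.triBdryIter G.verts G.base n).1) p) ∧ dist (Literature.Probability.LatticeModels.triMeshPoint δ (Literature.Probability.Percolation.triBdryIter G.verts G.base (m 1)).1) p < 2 * rN ∧ dist (Literature.Probability.LatticeModels.triMeshPoint δ (Literature.Probability.Percolation.triBdryIter G.verts G.base (m 2)).1) p < 2 * rN ∧ (∀ n, m 3 ≤ n → n < m 0 + (Literature.Probability.Percolation.triBdryDarts G.verts).card → R₂ < dist (Literature.Probability.LatticeModels.triMeshPoint δ (Literature.Probability.Percolation.triBdryIter G.verts G.base n).1) p) := by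
  intro G δ rN R₂ p hδ hrN hR hv1 hv0 hv2 harc
  classical
  set L := #(triBdryDarts G.verts) with hLdef
  have h12 : G.pos 1 < G.pos 2 := G.pos_lt_pos (by decide)
  have h23 : G.pos 2 < G.pos 3 := G.pos_lt_pos (by decide)
  have h3L : G.pos 3 < L := G.pos_lt 3
  have hp1 := G.two_le_pos_one
  have hp0 : G.pos 0 = 0 := G.pos_zero_eq
  have hδabs : |δ| = δ := abs_of_pos hδ
  -- tails: notation-free shorthands for the distance to `p`
  -- (T n = dist of the tail at position n)
  have hup : ∀ n k : ℕ, dist (triMeshPoint δ (triBdryIter G.verts G.base (n + k)).1) p ≤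
      dist (triMeshPoint δ (triBdryIter G.verts G.base n).1) p + k * δ := by
    intro n k
    have h := G.dist_iter_fst_le δ n k
    rw [hδabs] at h
    linarith [dist_triangle (triMeshPoint δ (triBdryIter G.verts G.base (n + k)).1)
      (triMeshPoint δ (triBdryIter G.verts G.base n).1) p,
      dist_comm (triMeshPoint δ (triBdryIter G.verts G.base (n + k)).1)
        (triMeshPoint δ (triBdryIter G.verts G.base n).1)]
  have hdn : ∀ n k : ℕ, dist (triMeshPoint δ (triBdryIter G.verts G.base n).1) p ≤
      dist (triMeshPoint δ (triBdryIter G.verts G.base (n + k)).1) p + k * δ := by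
    intro n k
    have h := G.dist_iter_fst_le δ n k
    rw [hδabs] at h
    linarith [dist_triangle (triMeshPoint δ (triBdryIter G.verts G.base n).1)
      (triMeshPoint δ (triBdryIter G.verts G.base (n + k)).1) p]
  have hm0 : (triBdryIter G.verts G.base 0).1 = G.markSite 0 := by
    show (triBdryIter G.verts G.base 0).1 = (triBdryIter G.verts G.base (G.pos 0)).1
    rw [hp0]
  have hms1 : (triBdryIter G.verts G.base (G.pos 1)).1 = G.markSite 1 := rfl
  have hms2 : (triBdryIter G.verts G.base (G.pos 2)).1 = G.markSite 2 := rfl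
  -- pos 2 - pos 1 ≥ 14
  have hgap12 : G.pos 1 + 14 ≤ G.pos 2 := by
    by_contra hlt
    push Not at hlt
    have h := hup (G.pos 1) (G.pos 2 - G.pos 1)
    rw [Nat.add_sub_cancel' h12.le, hms1, hms2] at h
    have h13 : ((G.pos 2 - G.pos 1 : ℕ) : ℝ) ≤ 13 := by exact_mod_cast (by omega : G.pos 2 - G.pos 1 ≤ 13)
    have := mul_le_mul_of_nonneg_right h13 hδ.le
    linarith
  have h7 : 7 ≤ L := by omega
  -- the first position whose tail is within `rN`
  set P₁ : ℕ → Prop := fun n => dist (triMeshPoint δ (triBdryIter G.verts G.base n).1) p < rN with hP₁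
  have hex1 : ∃ n, P₁ n := ⟨G.pos 1, by simp only [hP₁]; rw [hms1]; linarith⟩
  set m₁ := Nat.find hex1 with hm₁def
  have hm₁le : m₁ ≤ G.pos 1 := Nat.find_min' hex1 (by simp only [hP₁]; rw [hms1]; linarith)
  have hm₁spec : dist (triMeshPoint δ (triBdryIter G.verts G.base m₁).1) p < rN := Nat.find_spec hex1
  have hm₁min : ∀ n, n < m₁ → rN ≤ dist (triMeshPoint δ (triBdryIter G.verts G.base n).1) p :=
    fun n hn => not_lt.1 (Nat.find_min hex1 hn)
  -- the first position whose tail is within `R₂`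
  set P₀ : ℕ → Prop := fun n => dist (triMeshPoint δ (triBdryIter G.verts G.base n).1) p ≤ R₂ with hP₀
  have hex0 : ∃ n, P₀ n := ⟨m₁, by simp only [hP₀]; linarith⟩
  set m₀ := Nat.find hex0 with hm₀def
  have hm₀le : m₀ ≤ m₁ := Nat.find_min' hex0 (by simp only [hP₀]; linarith)
  have hm₀spec : dist (triMeshPoint δ (triBdryIter G.verts G.base m₀).1) p ≤ R₂ := Nat.find_spec hex0
  have hm₀min : ∀ n, n < m₀ → R₂ < dist (triMeshPoint δ (triBdryIter G.verts G.base n).1) p :=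
    fun n hn => not_le.1 (Nat.find_min hex0 hn)
  -- `m₀ ≥ 12`
  have hm₀ge : 12 ≤ m₀ := by
    by_contra hlt
    push Not at hlt
    have h := hdn 0 m₀
    rw [zero_add, hm0] at h
    have h11 : ((m₀ : ℕ) : ℝ) ≤ 11 := by exact_mod_cast (by omega : m₀ ≤ 11)
    have := mul_le_mul_of_nonneg_right h11 hδ.le
    linarith
  -- the tail at `m₀` is farther than `R₂ - δ`
  have hm₀far : R₂ - δ < dist (triMeshPoint δ (triBdryIter G.verts G.base m₀).1) p := by
    have h := hdn (m₀ - 1) 1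
    rw [show m₀ - 1 + 1 = m₀ by omega] at h
    have := hm₀min (m₀ - 1) (by omega)
    push_cast at h
    linarith
  -- `m₁ - m₀ ≥ 12`
  have hgap01 : m₀ + 12 ≤ m₁ := by
    by_contra hlt
    push Not at hlt
    have h := hdn m₀ (m₁ - m₀)
    rw [Nat.add_sub_cancel' hm₀le] at h
    have h11 : ((m₁ - m₀ : ℕ) : ℝ) ≤ 11 := by exact_mod_cast (by omega : m₁ - m₀ ≤ 11)
    have := mul_le_mul_of_nonneg_right h11 hδ.le
    linarith
  -- `pos 1 - m₁ ≥ 6`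
  have hgap1 : m₁ + 6 ≤ G.pos 1 := by
    by_contra hlt
    push Not at hlt
    have hpre := hm₁min (m₁ - 1) (by omega)
    have h := hdn (m₁ - 1) (G.pos 1 - (m₁ - 1))
    rw [show m₁ - 1 + (G.pos 1 - (m₁ - 1)) = G.pos 1 by omega, hms1] at h
    have h6 : ((G.pos 1 - (m₁ - 1) : ℕ) : ℝ) ≤ 6 := by
      exact_mod_cast (by omega : G.pos 1 - (m₁ - 1) ≤ 6)
    have := mul_le_mul_of_nonneg_right h6 hδ.le
    linarith
  -- the last position before `pos 2` whose tail is within `R₂`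
  set g := Nat.findGreatest P₀ (G.pos 2 - 1) with hgdef
  have hP₀1 : P₀ (G.pos 1 + 12) := by
    simp only [hP₀]
    have h := hup (G.pos 1) 12
    rw [hms1] at h
    push_cast at h
    linarith
  have hg12 : G.pos 1 + 12 ≤ g := Nat.le_findGreatest (by omega) hP₀1
  have hgle : g ≤ G.pos 2 - 1 := Nat.findGreatest_le _
  have hgspec : dist (triMeshPoint δ (triBdryIter G.verts G.base g).1) p ≤ R₂ :=
    Nat.findGreatest_spec (P := P₀) (by omega : G.pos 1 + 12 ≤ G.pos 2 - 1) hP₀1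
  have hgmax : ∀ n, g < n → n ≤ G.pos 2 - 1 →
      R₂ < dist (triMeshPoint δ (triBdryIter G.verts G.base n).1) p :=
    fun n h1 h2 => not_le.1 (Nat.findGreatest_is_greatest h1 h2)
  -- `pos 2 - g ≥ 14`
  have hgap2 : g + 14 ≤ G.pos 2 := by
    by_contra hlt
    push Not at hlt
    have h := hup g (G.pos 2 - g)
    rw [show g + (G.pos 2 - g) = G.pos 2 by omega, hms2] at h
    have h13 : ((G.pos 2 - g : ℕ) : ℝ) ≤ 13 := by exact_mod_cast (by omega : G.pos 2 - g ≤ 13)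
    have := mul_le_mul_of_nonneg_right h13 hδ.le
    linarith
  -- the four markable positions
  obtain ⟨a₀, ha₀1, ha₀2, hmk₀⟩ := G.exists_markable_near h7 (m₀ - 12)
  obtain ⟨a₁, ha₁1, ha₁2, hmk₁⟩ := G.exists_markable_near h7 (m₁ - 12)
  obtain ⟨a₂, ha₂1, ha₂2, hmk₂⟩ := G.exists_markable_near h7 (G.pos 1)
  obtain ⟨a₃, ha₃1, ha₃2, hmk₃⟩ := G.exists_markable_near h7 (g + 1)
  have ha₀le : a₀ ≤ m₀ := by omega
  have ha₁le : a₁ ≤ m₁ := by omega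
  -- distances of their tails
  have hda₀ : R₂ - δ < dist (triMeshPoint δ (triBdryIter G.verts G.base a₀).1) p := by
    rcases ha₀le.eq_or_lt with h | h
    · rw [h]; exact hm₀far
    · linarith [hm₀min a₀ h]
  have hda₁ : dist (triMeshPoint δ (triBdryIter G.verts G.base a₁).1) p < rN + 10 * δ := by
    have h := hdn a₁ (m₁ - a₁)
    rw [show a₁ + (m₁ - a₁) = m₁ by omega] at h
    have h10 : ((m₁ - a₁ : ℕ) : ℝ) ≤ 10 := by exact_mod_cast (by omega : m₁ - a₁ ≤ 10)
    have := mul_le_mul_of_nonneg_right h10 hδ.le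
    linarith
  have hda₂ : dist (triMeshPoint δ (triBdryIter G.verts G.base a₂).1) p < rN / 2 + 12 * δ := by
    have h := hup (G.pos 1) (a₂ - G.pos 1)
    rw [show G.pos 1 + (a₂ - G.pos 1) = a₂ by omega, hms1] at h
    have h12' : ((a₂ - G.pos 1 : ℕ) : ℝ) ≤ 12 := by exact_mod_cast (by omega : a₂ - G.pos 1 ≤ 12)
    have := mul_le_mul_of_nonneg_right h12' hδ.le
    linarith
  have hda₃ : R₂ < dist (triMeshPoint δ (triBdryIter G.verts G.base a₃).1) p :=
    hgmax a₃ (by omega) (by omega)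
  -- distinctness of the tails
  have hne01 : (triBdryIter G.verts G.base a₀).1 ≠ (triBdryIter G.verts G.base a₁).1 := by
    intro h; rw [h] at hda₀; linarith
  have hne02 : (triBdryIter G.verts G.base a₀).1 ≠ (triBdryIter G.verts G.base a₂).1 := by
    intro h; rw [h] at hda₀; linarith
  have hne13 : (triBdryIter G.verts G.base a₁).1 ≠ (triBdryIter G.verts G.base a₃).1 := by
    intro h; rw [h] at hda₁; linarith
  have hne23 : (triBdryIter G.verts G.base a₂).1 ≠ (triBdryIter G.verts G.base a₃).1 := by
    intro h; rw [h] at hda₂; linarith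
  have hne0v2 : (triBdryIter G.verts G.base a₀).1 ≠ G.markSite 2 :=
    G.fst_ne_markSite_of_lt (by omega) (by omega)
  have hne1v1 : (triBdryIter G.verts G.base a₁).1 ≠ G.markSite 1 :=
    G.fst_ne_markSite_of_lt (by omega) hp1
  have hne1v2 : (triBdryIter G.verts G.base a₁).1 ≠ G.markSite 2 := by
    intro h; rw [h] at hda₁; linarith
  have hne03 : (triBdryIter G.verts G.base a₀).1 ≠ (triBdryIter G.verts G.base a₃).1 := by
    intro h
    rcases G.tail_not_interleaved G.base_mem (n₁ := a₀) (n₂ := a₁) (n₃ := a₃) (n₄ := G.pos 2)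
      (by omega) (by omega) (by omega) (by omega) rfl h.symm with h' | h'
    · exact hne01 h'.symm
    · exact hne0v2 (by rw [← hms2]; exact h'.symm)
  have hne12 : (triBdryIter G.verts G.base a₁).1 ≠ (triBdryIter G.verts G.base a₂).1 := by
    intro h
    rcases G.tail_not_interleaved G.base_mem (n₁ := a₁) (n₂ := G.pos 1) (n₃ := a₂) (n₄ := G.pos 2)
      (by omega) (by omega) (by omega) (by omega) rfl h.symm with h' | h'
    · exact hne1v1 (by rw [← hms1]; exact h'.symm)
    · exact hne1v2 (by rw [← hms2]; exact h'.symm)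
  have hne2v0 : (triBdryIter G.verts G.base a₂).1 ≠ G.markSite 0 := by
    intro h; rw [h] at hda₂; linarith
  -- the marks
  set m : Fin 4 → ℕ := ![a₀, a₁, a₂, a₃] with hm
  have e0 : m 0 = a₀ := rfl
  have e1 : m 1 = a₁ := rfl
  have e2 : m 2 = a₂ := rfl
  have e3 : m 3 = a₃ := rfl
  have hmono : StrictMono m := by
    refine Fin.strictMono_iff_lt_succ.2 fun i => ?_
    fin_cases i
    · show a₀ < a₁; omega
    · show a₁ < a₂; omega
    · show a₂ < a₃; omega
  refine ⟨m, hmono, ?_, ?_, ?_, ?_, ?_, ?_, ?_, ?_, ?_, ?_, ?_, ?_⟩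
  · intro j
    have : m j ≤ a₃ := hmono.monotone (Fin.le_last j)
    rw [e0]; omega
  · intro j; fin_cases j
    · exact hmk₀
    · exact hmk₁
    · exact hmk₂
    · exact hmk₃
  · refine TriMarkedDomain.injective_fin_four ?_ ?_ ?_ ?_ ?_ ?_
    · exact hne01
    · exact hne02
    · exact hne03
    · exact hne12
    · exact hne13
    · exact hne23
  · rw [e1]; omega
  · rw [e2]; omega
  · rw [e2]; omega
  · rw [e3]; omega
  · rw [e2]; exact hne2v0
  · intro n hn1 hn2
    rw [e1] at hn2
    exact hm₁min n (by omega)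
  · rw [e1]; linarith
  · rw [e2]; linarith
  · intro n hn1 hn2
    rw [e3] at hn1; rw [e0] at hn2
    by_cases hn : n < G.pos 2
    · exact hgmax n (by omega) (by omega)
    by_cases hnL : n < L
    · push Not at hn
      apply harc
      by_cases hn3 : n < G.pos 3
      · exact Or.inl (G.mem_arc_iff_pos.2 ⟨n, hn, by rw [G.nextPos_of_lt 2 (by decide)]; exact hn3, rfl⟩)
      · push Not at hn3
        exact Or.inr (G.mem_arc_iff_pos.2 ⟨n, hn3, by rw [G.nextPos_three]; exact hnL, rfl⟩)
    · push Not at hnL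
      have e : n = (n - L) + L := by omega
      rw [e, G.iter_add_card]
      exact hm₀min (n - L) (by omega)

end Summit.CriticalPhenomena.CardyFormulaZ2.Theorems.BondTriangularCardyLine

end
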